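import Summits.CriticalPhenomena.PercolationContinuityZ3.Theorems.PercNearOneGluingNoHeavyLowerTailKNGoodGCThreeAssembly
import HarnessLib

/-!
# GC₃ from a SINGLE loneliness row (`NoHeavyLowerTail` cell, stmt-CriticalPhenomena-4575; prover `prim-hp-2`, gen 14) — tool file for
# `…KNGoodGCThreeAdjacent.lean` (GC₃ with adjacent children)

Support file (`--supports stmt-CriticalPhenomena-4575`).  No definitions, no named facts, no sorries.
Memo: `run/shared/lean/prim/prim-hp-2/MEMO-gen14-goodness-designated-forms.md` §6.

`KNGoodGC3.gc_threeRelays` (gen 12, p217910) proves the three-relay gluing inequality for two PENDANT stars `x, y` (no pair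
between them): with `j` the loneliest relay of `u = C + x + y`, the goodness functional of the glued observer `u[xy ↦ 1]` at the
witness `j` is non-negative.  Its proof uses the loneliness of `j` only through ONE row, `μ_u(j ↔ b) ≤ μ_u(a₁ ↔ b)` against the
core-loneliest relay `a₁`.  This file records exactly that:

* `KNGoodGC3Adj.gc_threeRelays_row` — `KNGoodGC3.gc_threeRelays` with the hypothesis `∀ a' ∈ A, μ_u(j↔b) ≤ μ_u(a'↔b)` weakened to the
  single row `μ_u(j↔b) ≤ μ_u(a₁↔b)`; the proof is the gen-12 proof VERBATIM (memo MEMO-gen12 §2: bottom case termwise, middle case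
  `gc3_middle`, top case `gc3_top`, each fed by the world form `twoStars_diff` of that one row).
The sequel `…KNGoodGCThreeAdjacent.lean` uses it twice (once for `j`, once for `a₁` itself) to treat children joined by a pair of any weight,
whence goodness of every separated quadruple with three relays and at most three vertices on the observer's side.
[cite: KozmaNitzan2024, Thms. 4–5 (pp. 12–14), Lemma 5 (p. 13), §3.2 Definition (p. 12); VandenbergHaggstromKahn2005, Thm. 1.5 (p. 7)]
-/

noncomputable section

namespace Summit.CriticalPhenomena.PercolationContinuityZ3.Theorems

open MeasureTheory Set Literature.Probability.LatticeModels Literature.Probability.Percolation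
open scoped Classical BigOperators

variable {n : ℕ}

namespace KNGoodGC3Adj

open ChampionStability KNGoodAux KNGoodHair KNGoodSeries KNGoodPortFree KNGoodTwoTwo KNGoodGC3

/-- **GC₃ from a single row.**  Verbatim `KNGoodGC3.gc_threeRelays` (two pendant stars `x, y` with ports in `A = {a₁,a₂,a₃}`, relays
labelled by core reliability), with the loneliness hypothesis of the witness `j` weakened to the one row the proof uses: `μ_u(j↔b) ≤ μ_u(a₁↔b)`.
[cite: KozmaNitzan2024, Thm. 4 (pp. 12–14), Lemma 5 (p. 13); VandenbergHaggstromKahn2005, Thm. 1.5 (p. 7)] -/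
theorem gc_threeRelays_row (u : Sym2 (Fin n) → unitInterval) (A : Finset (Fin n)) (hA : A.Nonempty)
    (x y b a₁ a₂ a₃ j : Fin n) (hAeq : A = {a₁, a₂, a₃}) (h12 : a₁ ≠ a₂) (h13 : a₁ ≠ a₃) (h23 : a₂ ≠ a₃)
    (hx : x ∉ A) (hy : y ∉ A) (hxy : x ≠ y) (hbx : b ≠ x) (hby : b ≠ y) (hjA : j ∈ A)
    (hxN : ∀ z : Fin n, z ∉ A → u s(x, z) = 0) (hyN : ∀ z : Fin n, z ∉ A → u s(y, z) = 0)
    (K : Sym2 (Fin n) → unitInterval) (hK : K = fun e => if x ∈ e then 0 else if y ∈ e then 0 else u e)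
    (hs12 : (prodBernoulli K).real (openConn a₁ b) ≤ (prodBernoulli K).real (openConn a₂ b))
    (hs23 : (prodBernoulli K).real (openConn a₂ b) ≤ (prodBernoulli K).real (openConn a₃ b))
    (hrow : (prodBernoulli u).real (openConn j b) ≤ (prodBernoulli u).real (openConn a₁ b)) :
    (prodBernoulli (Function.update u s(x, y) 1)).real (openConn j b) ≤
      (prodBernoulli (Function.update u s(x, y) 1)).real (openConn x b) +
        ∑ W ∈ nullSets A, (prodBernoulli (Function.update u s(x, y) 1)).real (clusterIs x W) *
          A.inf' hA (fun a' => (prodBernoulli (Function.update u s(x, y) 1)).real (openConnIn ((↑W : Set (Fin n))ᶜ) a' b)) := by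
  haveI : ∀ v : Sym2 (Fin n) → unitInterval, IsProbabilityMeasure (prodBernoulli v) := fun v => inferInstance
  have ha₁ : a₁ ∈ A := by rw [hAeq]; simp
  have ha₂ : a₂ ∈ A := by rw [hAeq]; simp
  have ha₃ : a₃ ∈ A := by rw [hAeq]; simp
  have hxa₁ : x ≠ a₁ := fun h => hx (h ▸ ha₁)
  have hxa₂ : x ≠ a₂ := fun h => hx (h ▸ ha₂)
  have hxa₃ : x ≠ a₃ := fun h => hx (h ▸ ha₃)
  have hya₁ : y ≠ a₁ := fun h => hy (h ▸ ha₁)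
  have hya₂ : y ≠ a₂ := fun h => hy (h ▸ ha₂)
  have hya₃ : y ≠ a₃ := fun h => hy (h ▸ ha₃)
  have notA : ∀ z : Fin n, z ≠ a₁ → z ≠ a₂ → z ≠ a₃ → z ∉ A := by
    intro z h1 h2 h3; rw [hAeq]; simp [h1, h2, h3]
  have hxN' : ∀ z : Fin n, z ≠ a₁ → z ≠ a₂ → z ≠ a₃ → u s(x, z) = 0 := fun z h1 h2 h3 => hxN z (notA z h1 h2 h3)
  have hyN' : ∀ z : Fin n, z ≠ a₁ → z ≠ a₂ → z ≠ a₃ → u s(y, z) = 0 := fun z h1 h2 h3 => hyN z (notA z h1 h2 h3)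
  have hxN3 : ∀ v : Fin n, v ∉ ({a₁, a₂, a₃} : Finset (Fin n)) → u s(x, v) = 0 := fun v hv => hxN v (by rwa [hAeq])
  have hyN3 : ∀ v : Fin n, v ∉ ({a₁, a₂, a₃} : Finset (Fin n)) → u s(y, v) = 0 := fun v hv => hyN v (by rwa [hAeq])
  -- the merged star
  obtain ⟨N, hagree, hisoN, hloopN, hN1, hN2, hN3, hKN⟩ :=
    mergedStar_exists u A hA x y b a₁ a₂ a₃ j hxy hxa₁ hxa₂ hxa₃ hya₁ hya₂ hya₃ h12 h13 h23 hy hjA hby hxN' hyN'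
  have hKN' : K = fun e => if x ∈ e then 0 else N e := by rw [hK, hKN]
  have h8 := agood_threePort_ge N A hA x b a₁ a₂ a₃ j h12 h13 h23 hx ha₁ ha₂ ha₃ hjA hbx hisoN hloopN K hKN'
  rw [hN1, hN2, hN3] at h8
  -- abbreviations
  set x₁ : ℝ := ((u s(x, a₁) : unitInterval) : ℝ) with hx₁
  set x₂ : ℝ := ((u s(x, a₂) : unitInterval) : ℝ) with hx₂
  set x₃ : ℝ := ((u s(x, a₃) : unitInterval) : ℝ) with hx₃
  set y₁ : ℝ := ((u s(y, a₁) : unitInterval) : ℝ) with hy₁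
  set y₂ : ℝ := ((u s(y, a₂) : unitInterval) : ℝ) with hy₂
  set y₃ : ℝ := ((u s(y, a₃) : unitInterval) : ℝ) with hy₃
  have bx₁ : 0 ≤ x₁ ∧ x₁ ≤ 1 := ⟨(u s(x, a₁)).2.1, (u s(x, a₁)).2.2⟩
  have bx₂ : 0 ≤ x₂ ∧ x₂ ≤ 1 := ⟨(u s(x, a₂)).2.1, (u s(x, a₂)).2.2⟩
  have bx₃ : 0 ≤ x₃ ∧ x₃ ≤ 1 := ⟨(u s(x, a₃)).2.1, (u s(x, a₃)).2.2⟩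
  have by₁ : 0 ≤ y₁ ∧ y₁ ≤ 1 := ⟨(u s(y, a₁)).2.1, (u s(y, a₁)).2.2⟩
  have by₂ : 0 ≤ y₂ ∧ y₂ ≤ 1 := ⟨(u s(y, a₂)).2.1, (u s(y, a₂)).2.2⟩
  have by₃ : 0 ≤ y₃ ∧ y₃ ≤ 1 := ⟨(u s(y, a₃)).2.1, (u s(y, a₃)).2.2⟩
  set s₁ := (prodBernoulli K).real (openConn a₁ b) with hs₁
  set s₂ := (prodBernoulli K).real (openConn a₂ b) with hs₂
  set s₃ := (prodBernoulli K).real (openConn a₃ b) with hs₃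
  set K12 : Sym2 (Fin n) → unitInterval := fun f => if f ∈ ({s(a₁, a₂)} : Finset (Sym2 (Fin n))) then 1 else K f with hK12
  set K13 : Sym2 (Fin n) → unitInterval := fun f => if f ∈ ({s(a₁, a₃)} : Finset (Sym2 (Fin n))) then 1 else K f with hK13
  set K23 : Sym2 (Fin n) → unitInterval := fun f => if f ∈ ({s(a₂, a₃)} : Finset (Sym2 (Fin n))) then 1 else K f with hK23
  set K123 : Sym2 (Fin n) → unitInterval :=
    fun f => if f ∈ ({s(a₁, a₂), s(a₁, a₃)} : Finset (Sym2 (Fin n))) then 1 else K f with hK123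
  -- ties inside the glued cores
  have t12 : (prodBernoulli K12).real (openConn a₁ b) = (prodBernoulli K12).real (openConn a₂ b) :=
    tie_of_mem K _ h12 (by simp) b
  have t13 : (prodBernoulli K13).real (openConn a₁ b) = (prodBernoulli K13).real (openConn a₃ b) :=
    tie_of_mem K _ h13 (by simp) b
  have t23 : (prodBernoulli K23).real (openConn a₂ b) = (prodBernoulli K23).real (openConn a₃ b) :=
    tie_of_mem K _ h23 (by simp) b
  have t123a : (prodBernoulli K123).real (openConn a₁ b) = (prodBernoulli K123).real (openConn a₂ b) :=
    tie_of_mem K _ h12 (by simp) b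
  have t123b : (prodBernoulli K123).real (openConn a₁ b) = (prodBernoulli K123).real (openConn a₃ b) :=
    tie_of_mem K _ h13 (by simp) b
  -- the minimum over `A` in the core is `s₁`
  have hinf : A.inf' hA (fun a => (prodBernoulli K).real (openConn a b)) = s₁ := by
    refine le_antisymm (Finset.inf'_le _ ha₁) ?_
    refine Finset.le_inf' hA _ fun a ha => ?_
    rw [hAeq] at ha; simp only [Finset.mem_insert, Finset.mem_singleton] at ha
    rcases ha with rfl | rfl | rfl
    · exact le_rfl
    · exact hs12
    · exact hs12.trans hs23
  rw [hinf] at h8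
  -- exchange rows (Kozma–Nitzan Lemma 5 / in-graph gluing transfer)
  have updF : ∀ c d : Fin n, Function.update K s(c, d) 1 =
      fun f => if f ∈ ({s(c, d)} : Finset (Sym2 (Fin n))) then 1 else K f := by
    intro c d; funext f; simp only [Function.update_apply, Finset.mem_singleton]
  have E1 : (prodBernoulli K23).real (openConn a₁ b) ≤ (prodBernoulli K23).real (openConn a₂ b) := by
    have h := glueTransfer_openConn K a₂ a₃ a₁ b h23 (hs12.trans hs23)
    rwa [updF] at h
  have E2 : (prodBernoulli K13).real (openConn a₂ b) ≤ (prodBernoulli K13).real (openConn a₁ b) := by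
    have h := glueTransfer_openConn K a₁ a₃ a₂ b h13 hs23
    rwa [updF] at h
  have Etie : s₃ ≤ s₁ → (prodBernoulli K12).real (openConn a₃ b) ≤ (prodBernoulli K12).real (openConn a₁ b) := by
    intro h
    have h' := glueTransfer_openConn K a₂ a₁ a₃ b (fun e => h12 e.symm) h
    rw [updF] at h'
    have hsw : ({s(a₂, a₁)} : Finset (Sym2 (Fin n))) = {s(a₁, a₂)} := by rw [Sym2.eq_swap]
    rw [hsw] at h'
    rw [t12]; exact h'
  -- merged hair bounds
  have hH₁ := merged_nonneg bx₁.1 by₁.1 by₁.2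
  have hH₁' := merged_le_one bx₁.2 by₁.2
  have hH₂ := merged_nonneg bx₂.1 by₂.1 by₂.2
  have hH₂' := merged_le_one bx₂.2 by₂.2
  have hH₃ := merged_nonneg bx₃.1 by₃.1 by₃.2
  have hH₃' := merged_le_one bx₃.2 by₃.2
  -- the goal is `0 ≤ agood(u[xy↦1], x; j)`
  rw [← sub_nonneg]
  have hgoal : (prodBernoulli (Function.update u s(x, y) 1)).real (openConn x b) +
        ∑ W ∈ nullSets A, (prodBernoulli (Function.update u s(x, y) 1)).real (clusterIs x W) *
          A.inf' hA (fun a' => (prodBernoulli (Function.update u s(x, y) 1)).real (openConnIn ((↑W : Set (Fin n))ᶜ) a' b)) -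
        (prodBernoulli (Function.update u s(x, y) 1)).real (openConn j b) =
      (prodBernoulli N).real (openConn x b) - (prodBernoulli N).real (openConn j b) +
        ∑ W ∈ nullSets A, (prodBernoulli N).real (clusterIs x W) *
          A.inf' hA (fun a' => (prodBernoulli N).real (openConnIn ((↑W : Set (Fin n))ᶜ) a' b)) := by
    rw [← hagree]; ring
  rw [hgoal]
  refine le_trans ?_ h8
  -- which relay is `j`?
  have hj : j = a₁ ∨ j = a₂ ∨ j = a₃ := by
    rw [hAeq] at hjA; simpa only [Finset.mem_insert, Finset.mem_singleton] using hjA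
  -- world weights
  set αx : ℝ := (1 - x₁) * (1 - x₂) * (1 - x₃) + x₁ * (1 - x₂) * (1 - x₃) + (1 - x₁) * x₂ * (1 - x₃) + (1 - x₁) * (1 - x₂) * x₃ with hαx
  set αy : ℝ := (1 - y₁) * (1 - y₂) * (1 - y₃) + y₁ * (1 - y₂) * (1 - y₃) + (1 - y₁) * y₂ * (1 - y₃) + (1 - y₁) * (1 - y₂) * y₃ with hαy
  rcases hj with hj | hj | hj
  · -- bottom case: every pattern term is non-negative
    rw [hj, ← hs₁]
    have c2 : 0 ≤ (1 - (x₁ + y₁ - x₁ * y₁)) * (x₂ + y₂ - x₂ * y₂) * (1 - (x₃ + y₃ - x₃ * y₃)) :=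
      mul_nonneg (mul_nonneg (by linarith) hH₂) (by linarith)
    have c3 : 0 ≤ (1 - (x₁ + y₁ - x₁ * y₁)) * (1 - (x₂ + y₂ - x₂ * y₂)) * (x₃ + y₃ - x₃ * y₃) :=
      mul_nonneg (mul_nonneg (by linarith) (by linarith)) hH₃
    have c23 : 0 ≤ (1 - (x₁ + y₁ - x₁ * y₁)) * (x₂ + y₂ - x₂ * y₂) * (x₃ + y₃ - x₃ * y₃) :=
      mul_nonneg (mul_nonneg (by linarith) hH₂) hH₃
    have hV2 : 0 ≤ s₂ - s₁ := sub_nonneg.2 hs12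
    have hV3 : 0 ≤ s₃ - s₁ := sub_nonneg.2 (hs12.trans hs23)
    have hV23 : 0 ≤ (prodBernoulli K23).real (openConn a₂ b) - (prodBernoulli K23).real (openConn a₁ b) := sub_nonneg.2 E1
    linarith [mul_nonneg c2 hV2, mul_nonneg c3 hV3, mul_nonneg c23 hV23]
  · -- middle case
    have hd := twoStars_diff u x y b a₁ a₂ a₃ h12 h13 h23 hxy hxa₁ hxa₂ hxa₃ hya₁ hya₂ hya₃ hbx hby hxN3 hyN3 K hK
      αx αy hαx hαy
    have hyp : 0 ≤ αx * αy * (s₁ - s₂) +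
        (x₁ * (1 - x₂) * x₃ * (αy + y₁ * (1 - y₂) * y₃) + y₁ * (1 - y₂) * y₃ * αx) *
          ((prodBernoulli K13).real (openConn a₁ b) - (prodBernoulli K13).real (openConn a₂ b)) +
        ((1 - x₁) * x₂ * x₃ * (αy + (1 - y₁) * y₂ * y₃) + (1 - y₁) * y₂ * y₃ * αx) *
          ((prodBernoulli K23).real (openConn a₁ b) - (prodBernoulli K23).real (openConn a₂ b)) := by
      have h0 : 0 ≤ (prodBernoulli u).real (openConn a₁ b) - (prodBernoulli u).real (openConn j b) :=
        sub_nonneg.2 hrow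
      rw [hj, hd] at h0; exact h0
    have hm := gc3_middle bx₁.1 bx₁.2 bx₂.1 bx₂.2 bx₃.1 bx₃.2 by₁.1 by₁.2 by₂.1 by₂.2 by₃.1 by₃.2 hαx hαy hs12 hs23 E2 E1 hyp
    rw [hj, ← hs₂, ← t12, ← t123a]
    have e : (1 - (x₁ + y₁ - x₁ * y₁)) * (1 - (x₂ + y₂ - x₂ * y₂)) * (1 - (x₃ + y₃ - x₃ * y₃)) * (s₁ - s₂) +
        (x₁ + y₁ - x₁ * y₁) * (1 - (x₂ + y₂ - x₂ * y₂)) * (1 - (x₃ + y₃ - x₃ * y₃)) * (s₁ - s₂) +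
        (1 - (x₁ + y₁ - x₁ * y₁)) * (x₂ + y₂ - x₂ * y₂) * (1 - (x₃ + y₃ - x₃ * y₃)) * (s₂ - s₂) +
        (1 - (x₁ + y₁ - x₁ * y₁)) * (1 - (x₂ + y₂ - x₂ * y₂)) * (x₃ + y₃ - x₃ * y₃) * (s₃ - s₂) +
        (x₁ + y₁ - x₁ * y₁) * (x₂ + y₂ - x₂ * y₂) * (1 - (x₃ + y₃ - x₃ * y₃)) *
          ((prodBernoulli K12).real (openConn a₁ b) - (prodBernoulli K12).real (openConn a₁ b)) +
        (x₁ + y₁ - x₁ * y₁) * (1 - (x₂ + y₂ - x₂ * y₂)) * (x₃ + y₃ - x₃ * y₃) *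
          ((prodBernoulli K13).real (openConn a₁ b) - (prodBernoulli K13).real (openConn a₂ b)) +
        (1 - (x₁ + y₁ - x₁ * y₁)) * (x₂ + y₂ - x₂ * y₂) * (x₃ + y₃ - x₃ * y₃) *
          ((prodBernoulli K23).real (openConn a₂ b) - (prodBernoulli K23).real (openConn a₂ b)) +
        (x₁ + y₁ - x₁ * y₁) * (x₂ + y₂ - x₂ * y₂) * (x₃ + y₃ - x₃ * y₃) *
          ((prodBernoulli K123).real (openConn a₁ b) - (prodBernoulli K123).real (openConn a₁ b)) =
      (1 - (x₂ + y₂ - x₂ * y₂)) * ((1 - (x₃ + y₃ - x₃ * y₃)) * (s₁ - s₂) +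
        (x₃ + y₃ - x₃ * y₃) * (1 - (x₁ + y₁ - x₁ * y₁)) * (s₃ - s₂) +
        (x₁ + y₁ - x₁ * y₁) * (x₃ + y₃ - x₃ * y₃) *
          ((prodBernoulli K13).real (openConn a₁ b) - (prodBernoulli K13).real (openConn a₂ b))) := by
      ring
    linarith [hm, e]
  · -- top case
    have hP : ({a₁, a₃, a₂} : Finset (Fin n)) = {a₁, a₂, a₃} := congrArg _ (Finset.pair_comm a₃ a₂)
    have hxN3' : ∀ v : Fin n, v ∉ ({a₁, a₃, a₂} : Finset (Fin n)) → u s(x, v) = 0 := fun v hv => hxN3 v (by rwa [hP] at hv)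
    have hyN3' : ∀ v : Fin n, v ∉ ({a₁, a₃, a₂} : Finset (Fin n)) → u s(y, v) = 0 := fun v hv => hyN3 v (by rwa [hP] at hv)
    have hd := twoStars_diff u x y b a₁ a₃ a₂ h13 h12 (fun e => h23 e.symm) hxy hxa₁ hxa₃ hxa₂ hya₁ hya₃ hya₂ hbx hby
      hxN3' hyN3' K hK αx αy (by rw [hαx]; ring) (by rw [hαy]; ring)
    have hsw : ({s(a₃, a₂)} : Finset (Sym2 (Fin n))) = {s(a₂, a₃)} := by rw [Sym2.eq_swap]
    rw [hsw] at hd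
    have hyp : 0 ≤ αx * αy * (s₁ - s₃) +
        (x₁ * x₂ * (1 - x₃) * (αy + y₁ * y₂ * (1 - y₃)) + y₁ * y₂ * (1 - y₃) * αx) *
          ((prodBernoulli K12).real (openConn a₁ b) - (prodBernoulli K12).real (openConn a₃ b)) +
        ((1 - x₁) * x₂ * x₃ * (αy + (1 - y₁) * y₂ * y₃) + (1 - y₁) * y₂ * y₃ * αx) *
          ((prodBernoulli K23).real (openConn a₁ b) - (prodBernoulli K23).real (openConn a₂ b)) := by
      have h0 : 0 ≤ (prodBernoulli u).real (openConn a₁ b) - (prodBernoulli u).real (openConn j b) :=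
        sub_nonneg.2 hrow
      rw [hj, hd, ← t23] at h0
      have e : x₁ * (1 - x₃) * x₂ * (αy + y₁ * (1 - y₃) * y₂) + y₁ * (1 - y₃) * y₂ * αx =
          x₁ * x₂ * (1 - x₃) * (αy + y₁ * y₂ * (1 - y₃)) + y₁ * y₂ * (1 - y₃) * αx := by ring
      have e' : (1 - x₁) * x₃ * x₂ * (αy + (1 - y₁) * y₃ * y₂) + (1 - y₁) * y₃ * y₂ * αx =
          (1 - x₁) * x₂ * x₃ * (αy + (1 - y₁) * y₂ * y₃) + (1 - y₁) * y₂ * y₃ * αx := by ring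
      rw [e, e'] at h0; exact h0
    have ht := gc3_top bx₁.1 bx₁.2 bx₂.1 bx₂.2 bx₃.1 bx₃.2 by₁.1 by₁.2 by₂.1 by₂.2 by₃.1 by₃.2 hαx hαy hs12 hs23 E1 Etie hyp
    rw [hj, ← hs₃, ← t13, ← t23, ← t123b]
    have e : (1 - (x₁ + y₁ - x₁ * y₁)) * (1 - (x₂ + y₂ - x₂ * y₂)) * (1 - (x₃ + y₃ - x₃ * y₃)) * (s₁ - s₃) +
        (x₁ + y₁ - x₁ * y₁) * (1 - (x₂ + y₂ - x₂ * y₂)) * (1 - (x₃ + y₃ - x₃ * y₃)) * (s₁ - s₃) +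
        (1 - (x₁ + y₁ - x₁ * y₁)) * (x₂ + y₂ - x₂ * y₂) * (1 - (x₃ + y₃ - x₃ * y₃)) * (s₂ - s₃) +
        (1 - (x₁ + y₁ - x₁ * y₁)) * (1 - (x₂ + y₂ - x₂ * y₂)) * (x₃ + y₃ - x₃ * y₃) * (s₃ - s₃) +
        (x₁ + y₁ - x₁ * y₁) * (x₂ + y₂ - x₂ * y₂) * (1 - (x₃ + y₃ - x₃ * y₃)) *
          ((prodBernoulli K12).real (openConn a₁ b) - (prodBernoulli K12).real (openConn a₃ b)) +
        (x₁ + y₁ - x₁ * y₁) * (1 - (x₂ + y₂ - x₂ * y₂)) * (x₃ + y₃ - x₃ * y₃) *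
          ((prodBernoulli K13).real (openConn a₁ b) - (prodBernoulli K13).real (openConn a₁ b)) +
        (1 - (x₁ + y₁ - x₁ * y₁)) * (x₂ + y₂ - x₂ * y₂) * (x₃ + y₃ - x₃ * y₃) *
          ((prodBernoulli K23).real (openConn a₂ b) - (prodBernoulli K23).real (openConn a₂ b)) +
        (x₁ + y₁ - x₁ * y₁) * (x₂ + y₂ - x₂ * y₂) * (x₃ + y₃ - x₃ * y₃) *
          ((prodBernoulli K123).real (openConn a₁ b) - (prodBernoulli K123).real (openConn a₁ b)) =
      (1 - (x₃ + y₃ - x₃ * y₃)) * ((1 - (x₂ + y₂ - x₂ * y₂)) * (s₁ - s₃) +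
        (x₂ + y₂ - x₂ * y₂) * (1 - (x₁ + y₁ - x₁ * y₁)) * (s₂ - s₃) +
        (x₁ + y₁ - x₁ * y₁) * (x₂ + y₂ - x₂ * y₂) *
          ((prodBernoulli K12).real (openConn a₁ b) - (prodBernoulli K12).real (openConn a₃ b))) := by
      ring
    linarith [ht, e]


end KNGoodGC3Adj

end Summit.CriticalPhenomena.PercolationContinuityZ3.Theorems
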